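import Literature.AlgebraicTopology.CharacteristicClasses.LineLocalIndexDegree
import Literature.AlgebraicTopology.SingularHomology.OrientationReversingHomeomorph
import Literature.Geometry.Symplectic.SymplecticOrientation
import Literature.Geometry.Symplectic.AlmostComplexTangentBundle
import HarnessLib

/-!
# Sign coherence for the local indices of `(TS, j)` over a surface oriented by a taming `2`-form

D. McDuff, D. Salamon, *Introduction to Symplectic Topology*, 3rd ed. (2017), Thm. 2.7.5 (the first
Chern number of a line bundle over a closed oriented surface is the count of the zeros of a transverse
section with the signs of their Jacobians) and §2.5 eq. (2.5.3) (`ω`-tame complex structures: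
`ω(v, Jv) > 0`).  In the tree's localisation of `⟨e(L), [S]_μ⟩` the local index at a zero `p` of a
section with non-degenerate linearisation `A` is `sign det(A) · κ(g)`
(`localIndex_eq_sign_det_mul_lineIndexUnit`, `LineLocalIndexDegree`), where `g` is the orientation of
`ℝ²` whose chart transport is `μ_p` and `κ(g) = lineIndexUnit g = ±1`.  For the area orientation
`μ = surfaceOrientation t` of a nondegenerate `2`-form `t` (built from an ORIENTED ATLAS through the
reference orientations `μR o p = (μE 2).comap (Rh o p)`, `Rh` = identity or reflection according to the
orientation of the preferred chart at `p`), and for the section of `(TS, j)` attached to a vector field,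
`A = Λ_p ∘ L_p` with `Λ_p` the tangent plane map `T_pS = ℝ² → (T_pS, j_p) ≅ ℂ → ℝ²` and `L_p` the
linearisation of the field in the chart.  This file proves that the two chart-dependent signs cancel:

* `lineIndexUnit_μR` — `κ(μR o p) = ±κ(μE)` according as the preferred chart at `p` is positively
  oriented; the reflection reverses the reference orientation (`comap_reflHomeo_μE_localClass`, from the
  tree's fixed-point Jacobian criterion `comap_localClass_eq_neg_of_hasFDerivAt`);
* `det_tangentPlaneMap_pos_iff` — for `j` tamed by `t`, `0 < det Λ_p ↔ 0 < t_p(e₀, e₁)`: `Λ_p` is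
  complex linear (`Λ_p j_p = i Λ_p`, `tangentPlaneMap_apply_J`), so `det Λ_p · det[v, j_p v] =
  det[Λ_p v, i Λ_p v] = |Λ_p v|² > 0`, while tameness gives `t_p(e₀, e₁) · det[v, j_p v] = t_p(v, j_p v) > 0`;
* `sign_mul_lineIndexUnit_μR` — hence `sign det(Λ_p L_p) · κ(μR o p) = sign det(L_p) · κ(μE)`.

Everything is proved; no named facts.

## References

* [McDuffSalamon2017] D. McDuff, D. Salamon, Introduction to Symplectic Topology, 3rd ed., OUP 2017,
  §2.1, §2.5 eq. (2.5.3), Thm. 2.7.5.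
* [HirschDT1976] M. W. Hirsch, Differential Topology, GTM 33, Springer 1976, Ch. 4 §4 (orientations
  and Jacobian signs).
-/

noncomputable section

open scoped Manifold ContDiff Topology
open Set Function Filter Module
open Literature.AlgebraicTopology.SingularHomology Literature.AlgebraicTopology.CharacteristicClasses
open Literature.Topology.FourManifolds Literature.Topology.FourManifolds.HomologicalOrientationOfSmooth
open Literature.Geometry.Kaehler

/-- Local notation: `𝔼 n` is the model Euclidean space `EuclideanSpace ℝ (Fin n)`. -/
local notation "𝔼 " n:arg => EuclideanSpace ℝ (Fin n)

namespace Literature.Geometry.Symplectic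

/-! ### The index unit of the reference orientations `μR o p` -/

section IndexUnit

/-- `((μE 2).comap refl)_0 = (μE 2)_0`. [folklore] -/
theorem comap_refl_μE_localClass :
    ((μE 2).comap (Homeomorph.refl (𝔼 2))).localClass 0 = (μE 2).localClass 0 := by
  rw [pres_iff_comap_eq.1 (pres_refl (μE 2))]

/-- **The reflection reverses the reference orientation of the plane at the origin**:
`((μE 2).comap r)_0 = -(μE 2)_0` (its Jacobian `r` has determinant `-1`; the tree's fixed-point
criterion `comap_localClass_eq_neg_of_hasFDerivAt`). [cite: HirschDT1976, Ch. 4 §4 pp. 105–106] -/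
theorem comap_reflHomeo_μE_localClass :
    ((μE 2).comap (reflHomeo (n := 2))).localClass 0 = -(μE 2).localClass 0 := by
  have hdet : LinearMap.det ((reflE (n := 2) : (𝔼 2) →L[ℝ] 𝔼 2) : (𝔼 2) →ₗ[ℝ] 𝔼 2) < 0 := by
    have h : LinearMap.det ((reflE (n := 2) : (𝔼 2) →L[ℝ] 𝔼 2) : (𝔼 2) →ₗ[ℝ] 𝔼 2) = -1 :=
      det_reflE (n := 2) two_pos
    rw [h]
    norm_num
  have hA : HasFDerivAt (fun v : 𝔼 2 ↦ (OpenPartialHomeomorph.refl (𝔼 2))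
      (reflHomeo (n := 2) ((OpenPartialHomeomorph.refl (𝔼 2)).symm v))) (reflE (n := 2))
      ((OpenPartialHomeomorph.refl (𝔼 2)) 0) :=
    (reflE (n := 2)).hasFDerivAt
  exact (μE 2).comap_localClass_eq_neg_of_hasFDerivAt (reflHomeo (n := 2)) (by simp)
    (OpenPartialHomeomorph.refl (𝔼 2)) (mem_univ _) hA hdet

/-- The index unit only sees the local class at the origin: opposite classes give opposite units. [folklore] -/
theorem lineIndexUnit_eq_neg_of_localClass_eq_neg {g g' : HomologicalOrientation ℤ (𝔼 2) 2}
    (h : g.localClass 0 = -g'.localClass 0) : lineIndexUnit g = -lineIndexUnit g' := by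
  simp only [lineIndexUnit, planeGenerator, h, map_neg]

/-- The index unit only sees the local class at the origin. [folklore] -/
theorem lineIndexUnit_eq_of_localClass_eq {g g' : HomologicalOrientation ℤ (𝔼 2) 2}
    (h : g.localClass 0 = g'.localClass 0) : lineIndexUnit g = lineIndexUnit g' := by
  simp only [lineIndexUnit, planeGenerator, h]

variable {S : Type*} [TopologicalSpace S] [ChartedSpace (𝔼 2) S] [IsManifold (𝓡 2) 1 S]

open Classical in
/-- **The index unit of the oriented reference orientation at `p`**: `κ(μR o p) = ±κ(μE)` according
as the preferred chart at `p` is positively oriented (`o p = [e₀, e₁]`) or not. [folklore] -/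
theorem lineIndexUnit_μR (o : SmoothOrientation (𝓡 2) S) (p : S) :
    lineIndexUnit (μR o p) = if o p = euclideanOrientation 2 then lineIndexUnit (μE 2) else -lineIndexUnit (μE 2) := by
  unfold μR Rh
  split_ifs with h
  · exact lineIndexUnit_eq_of_localClass_eq comap_refl_μE_localClass
  · exact lineIndexUnit_eq_neg_of_localClass_eq_neg comap_reflHomeo_μE_localClass

open Classical in
/-- **Sign bookkeeping**: if the sign of `dΛ` records the orientation of the preferred chart at `p`,
then `sign(dΛ · dL) κ(μR o p) = sign(dL) κ(μE)`. [folklore] -/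
theorem sign_mul_lineIndexUnit_μR (o : SmoothOrientation (𝓡 2) S) (p : S) {dΛ dL : ℝ}
    (hΛ : 0 < dΛ ↔ o p = euclideanOrientation 2) (hΛ0 : dΛ ≠ 0) (hL0 : dL ≠ 0) :
    (if 0 < dΛ * dL then (1 : ℤ) else -1) * lineIndexUnit (μR o p) =
      (if 0 < dL then (1 : ℤ) else -1) * lineIndexUnit (μE 2) := by
  rw [lineIndexUnit_μR]
  by_cases ho : o p = euclideanOrientation 2
  · have hΛp : 0 < dΛ := hΛ.2 ho
    have hiff : (0 < dΛ * dL ↔ 0 < dL) := mul_pos_iff_of_pos_left hΛp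
    rw [if_pos ho]
    by_cases hL : 0 < dL
    · rw [if_pos (hiff.2 hL), if_pos hL]
    · rw [if_neg (mt hiff.1 hL), if_neg hL]
  · have hΛn : dΛ < 0 := lt_of_le_of_ne (not_lt.1 (mt hΛ.1 ho)) hΛ0
    have hiff : (0 < dΛ * dL ↔ dL < 0) := by
      rw [← neg_mul_neg, mul_pos_iff_of_pos_left (neg_pos.2 hΛn), neg_pos]
    rw [if_neg ho]
    by_cases hL : 0 < dL
    · rw [if_neg (fun h ↦ lt_asymm hL (hiff.1 h)), if_pos hL]
      ring
    · rw [if_pos (hiff.2 (lt_of_le_of_ne (not_lt.1 hL) hL0)), if_neg hL]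
      ring

end IndexUnit

/-! ### Linear algebra in the plane: `Λ(Jv) = rot(Λ v)` and `det[w, rot w] > 0` -/

section Plane

/-- The standard determinant on `ℝ²`: `det[v, w] = v₀ w₁ - w₀ v₁`. [folklore] -/
theorem basisFun_det_pair (v w : 𝔼 2) :
    (EuclideanSpace.basisFun (Fin 2) ℝ).toBasis.det ![v, w] = v 0 * w 1 - w 0 * v 1 := by
  rw [Module.Basis.det_apply, Matrix.det_fin_two]
  simp [Module.Basis.toMatrix_apply, OrthonormalBasis.coe_toBasis_repr_apply, EuclideanSpace.basisFun_repr]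

/-- `L⁻¹ w = w₀ + i w₁`. [folklore] -/
theorem lineToPlane_symm_apply (w : 𝔼 2) : (lineToPlane.symm w).down = ⟨w 0, w 1⟩ := by
  have h : lineToPlane (ULift.up (⟨w 0, w 1⟩ : ℂ)) = w := by
    ext i
    rw [lineToPlane_apply]
    fin_cases i <;> rfl
  have h' := congrArg lineToPlane.symm h
  rw [ContinuousLinearEquiv.symm_apply_apply] at h'
  rw [← h']

/-- **Multiplication by `i` read in the plane**: `rot w := L (i · L⁻¹ w)`. [folklore] -/
def rot (w : 𝔼 2) : 𝔼 2 := lineToPlane (Complex.I • lineToPlane.symm w)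

/-- `rot (a, b) = (-b, a)`. [folklore] -/
theorem rot_apply (w : 𝔼 2) : rot w 0 = -w 1 ∧ rot w 1 = w 0 := by
  have hz : (Complex.I • lineToPlane.symm w).down = (⟨-w 1, w 0⟩ : ℂ) := by
    rw [ULift.smul_down, lineToPlane_symm_apply, smul_eq_mul]
    apply Complex.ext <;> simp
  refine ⟨?_, ?_⟩
  · rw [rot, lineToPlane_apply, hz]
    rfl
  · rw [rot, lineToPlane_apply, hz]
    rfl

/-- **`det[w, rot w] = |w|² > 0` for `w ≠ 0`.** [folklore] -/
theorem basisFun_det_rot_pos {w : 𝔼 2} (hw : w ≠ 0) :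
    0 < (EuclideanSpace.basisFun (Fin 2) ℝ).toBasis.det ![w, rot w] := by
  rw [basisFun_det_pair, (rot_apply w).1, (rot_apply w).2]
  have h : w 0 ≠ 0 ∨ w 1 ≠ 0 := by
    by_contra hcon
    push Not at hcon
    apply hw
    ext i
    fin_cases i
    · exact hcon.1
    · exact hcon.2
  rcases h with h | h
  · have := mul_self_pos.2 h
    nlinarith [mul_self_nonneg (w 1)]
  · have := mul_self_pos.2 h
    nlinarith [mul_self_nonneg (w 0)]

end Plane

/-! ### The tangent plane map of `(TS, j)` at `p` and its orientation behaviour -/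

section Tangent

variable {S : Type*} [TopologicalSpace S] [ChartedSpace (𝔼 2) S] [IsManifold (𝓡 2) 1 S] {n : WithTop ℕ∞}
  (j : AlmostComplexStructure (𝓡 2) n S) (hF : finrank ℂ (Fin (finrank ℝ (𝔼 2) / 2) → ℂ) = 1)

variable {j} in
/-- The standard identification `ℂ¹ ≅ ℂ` of the model fibre, as a REAL continuous linear equivalence. [folklore] -/
def stdEquivR : (Fin (finrank ℝ (𝔼 2) / 2) → ℂ) ≃L[ℝ] ULift.{0} ℂ where
  toLinearEquiv := (stdEquiv (Fin (finrank ℝ (𝔼 2) / 2) → ℂ) hF).toLinearEquiv.restrictScalars ℝ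
  continuous_toFun := (stdEquiv (Fin (finrank ℝ (𝔼 2) / 2) → ℂ) hF).continuous
  continuous_invFun := (stdEquiv (Fin (finrank ℝ (𝔼 2) / 2) → ℂ) hF).symm.continuous

/-- **The tangent plane map `Λ_p : ℝ² ≅ ℝ²` at `p`**: `T_pS = ℝ² →β_p→ ℂ¹ →std→ ℂ →(re, im)→ ℝ²` — the
linear part of the local representative of a section of `(TS, j)` coming from a vector field.
[cite: McDuffSalamon2017, Thm. 2.7.5] -/
def tangentPlaneEquiv (p : S) : (𝔼 2) ≃L[ℝ] 𝔼 2 :=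
  (j.modelIsoAt p).trans ((stdEquivR hF).trans lineToPlane)

/-- The tangent plane map as a continuous linear map. [folklore] -/
abbrev tangentPlaneMap (p : S) : (𝔼 2) →L[ℝ] 𝔼 2 := (tangentPlaneEquiv j hF p : (𝔼 2) →L[ℝ] 𝔼 2)

/-- `Λ_p v = L (std (β_p v))`. [folklore] -/
theorem tangentPlaneMap_apply (p : S) (v : 𝔼 2) :
    tangentPlaneMap j hF p v = lineToPlane (stdEquiv (Fin (finrank ℝ (𝔼 2) / 2) → ℂ) hF (j.modelIsoAt p v)) := rfl

/-- **`Λ_p` is complex-linear for `j_p` and `i`**: `Λ_p (j_p v) = rot (Λ_p v)` (`β_p j_p = i β_p`).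
[cite: McDuffSalamon2017, §2.6] -/
theorem tangentPlaneMap_apply_J (p : S) (v : 𝔼 2) :
    tangentPlaneMap j hF p (j p v) = rot (tangentPlaneMap j hF p v) := by
  rw [tangentPlaneMap_apply, tangentPlaneMap_apply, rot, ContinuousLinearEquiv.symm_apply_apply,
    show j p v = j.Jm p v from rfl, AlmostComplexStructure.modelIsoAt_apply_Jm, ContinuousLinearEquiv.map_smul]

/-- `det Λ_p ≠ 0`. [folklore] -/
theorem det_tangentPlaneMap_ne_zero (p : S) :
    LinearMap.det ((tangentPlaneMap j hF p : (𝔼 2) →L[ℝ] 𝔼 2) : (𝔼 2) →ₗ[ℝ] 𝔼 2) ≠ 0 :=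
  (tangentPlaneEquiv j hF p).toLinearEquiv.isUnit_det'.ne_zero

/-- **The tangent plane map is orientation-preserving exactly when the preferred chart at `p` is
positively oriented for the area orientation of a taming form**: for `j` tamed by `t`,
`0 < det Λ_p ↔ 0 < t_p(e₀, e₁)`.  Indeed `det Λ_p · det[v, j v] = det[Λ v, rot Λ v] > 0` and
`t_p(e₀, e₁) · det[v, j v] = t_p(v, j v) > 0`. [cite: McDuffSalamon2017, §2.5 eq. (2.5.3) (ω-tame) and §2.1] -/
theorem det_tangentPlaneMap_pos_iff {t : MForm (𝓡 2) S ℝ 2} (hJ : j.IsTamedBy t) (p : S) :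
    0 < LinearMap.det ((tangentPlaneMap j hF p : (𝔼 2) →L[ℝ] 𝔼 2) : (𝔼 2) →ₗ[ℝ] 𝔼 2) ↔ 0 < coeffTwo (t p) := by
  set b := (EuclideanSpace.basisFun (Fin 2) ℝ).toBasis with hb
  set v : 𝔼 2 := b 0 with hv
  have hv0 : v ≠ 0 := b.ne_zero 0
  set d : ℝ := b.det ![v, j p v] with hd
  -- (1) `det Λ · d = det[Λ v, rot Λ v] > 0`
  have h1 : LinearMap.det ((tangentPlaneMap j hF p : (𝔼 2) →L[ℝ] 𝔼 2) : (𝔼 2) →ₗ[ℝ] 𝔼 2) * d =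
      b.det ![tangentPlaneMap j hF p v, rot (tangentPlaneMap j hF p v)] := by
    rw [← tangentPlaneMap_apply_J, hd,
      ← Module.Basis.det_comp b ((tangentPlaneMap j hF p : (𝔼 2) →L[ℝ] 𝔼 2) : (𝔼 2) →ₗ[ℝ] 𝔼 2) ![v, j p v]]
    congr 1
    funext i
    fin_cases i <;> rfl
  have h2 : 0 < LinearMap.det ((tangentPlaneMap j hF p : (𝔼 2) →L[ℝ] 𝔼 2) : (𝔼 2) →ₗ[ℝ] 𝔼 2) * d := by
    rw [h1]
    refine basisFun_det_rot_pos fun h ↦ hv0 ((tangentPlaneEquiv j hF p).injective ?_)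
    rw [map_zero]
    exact h
  -- (2) `c(t_p) · d = t_p(v, j v) > 0`
  have h3 : coeffTwo (t p) * d = t p ![v, j p v] := by
    have key := congrArg (fun α : (𝔼 2) [⋀^Fin 2]→ₗ[ℝ] ℝ ↦ α ![v, j p v])
      (toAlternatingMap_eq_coeffTwo_smul_det (t p))
    simp only [AlternatingMap.smul_apply, smul_eq_mul] at key
    exact key.symm
  have h4 : 0 < coeffTwo (t p) * d := by
    rw [h3]
    exact hJ p v hv0
  -- both `det Λ` and `c(t_p)` have the sign of `d`
  rcases lt_trichotomy d 0 with hdn | hd0 | hdp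
  · have hx : LinearMap.det ((tangentPlaneMap j hF p : (𝔼 2) →L[ℝ] 𝔼 2) : (𝔼 2) →ₗ[ℝ] 𝔼 2) < 0 :=
      ((mul_pos_iff.1 h2).resolve_left fun h ↦ lt_asymm hdn h.2).1
    have hc : coeffTwo (t p) < 0 := ((mul_pos_iff.1 h4).resolve_left fun h ↦ lt_asymm hdn h.2).1
    exact iff_of_false (not_lt.2 hx.le) (not_lt.2 hc.le)
  · rw [hd0, mul_zero] at h2
    exact absurd h2 (lt_irrefl 0)
  · exact iff_of_true ((mul_pos_iff_of_pos_right hdp).1 h2) ((mul_pos_iff_of_pos_right hdp).1 h4)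

variable [IsManifold (𝓡 2) ∞ S]

omit [IsManifold (𝓡 2) 1 S] in
/-- The area orientation reads `[e₀, e₁]` at `p` iff `t_p(e₀, e₁) > 0`. [folklore] -/
theorem surfaceSmoothOrientation_eq_iff (t : MForm (𝓡 2) S ℝ 2) (ht : IsSmoothForm t)
    (hnd : ∀ y (v : TangentSpace (𝓡 2) y), v ≠ 0 → ∃ w : TangentSpace (𝓡 2) y, t y ![v, w] ≠ 0) (p : S) :
    surfaceSmoothOrientation t ht hnd p = euclideanOrientation 2 ↔ 0 < coeffTwo (t p) := by
  rw [surfaceSmoothOrientation_apply]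
  unfold signOrientationIn
  split_ifs with h
  · exact iff_of_true rfl h
  · exact iff_of_false (Module.Ray.ne_neg_self _).symm h

/-- **Orientation coherence of the tangent plane maps**: for `j` tamed by `t` and the area
orientation `o_t` of `t`, `0 < det Λ_p ↔ o_t p = [e₀, e₁]` at EVERY point `p`. [cite: McDuffSalamon2017, §2.5 eq. (2.5.3) and §2.1] -/
theorem det_tangentPlaneMap_pos_iff_orientation {t : MForm (𝓡 2) S ℝ 2} (ht : IsSmoothForm t)
    (hnd : ∀ y (v : TangentSpace (𝓡 2) y), v ≠ 0 → ∃ w : TangentSpace (𝓡 2) y, t y ![v, w] ≠ 0)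
    (hJ : j.IsTamedBy t) (p : S) :
    0 < LinearMap.det ((tangentPlaneMap j hF p : (𝔼 2) →L[ℝ] 𝔼 2) : (𝔼 2) →ₗ[ℝ] 𝔼 2) ↔
      surfaceSmoothOrientation t ht hnd p = euclideanOrientation 2 := by
  rw [det_tangentPlaneMap_pos_iff j hF hJ, surfaceSmoothOrientation_eq_iff]

end Tangent

end Literature.Geometry.Symplectic
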